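import Mathlib
import Literature.NumberTheory.LFunctions.Zhang2022.SkeletonPropositions
import Literature.NumberTheory.LFunctions.Zhang2022.Section3Lemma31
import Literature.NumberTheory.LFunctions.Zhang2022.Section4Lemma43
import Literature.NumberTheory.LFunctions.Zhang2022.Section4TildeZ
import HarnessLib

/-!
# Zhang (2022), typed skeleton V: Part I nodes — §3 (Lemmas 3.1–3.6 ⇒ Proposition 2.1) and §4
# (the mollified polynomials `F, G`, the approximate functional equation, `𝒜`, `ℬ`, Lemmas 4.1–4.8)

Topic `Literature/NumberTheory/LFunctions/Zhang2022` (Landau–Siegel audit tree; verdict-neutral).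
Y. Zhang, *Discrete mean estimates and the Landau–Siegel zero*, arXiv:2211.02515v1 (2022)
[Zhang2022LandauSiegel] — **an unrefereed manuscript under adjudication; every `def … : Prop` below
is a CLAIM OF THE MANUSCRIPT, STATED NOT ASSERTED** (named hypotheses one layer below
`SkeletonPropositions.Prop21` / `Prop22`), except where a `_holds` theorem DISCHARGES it from the
tree. Kernel-checked here:

* `prop21_of_lemmas` — **§3 p. 7: "Proposition 2.1 follows from Lemma 3.4, 3.5 and 3.6
  immediately"** (union bound over the three exceptional sets, `𝓛⁻⁷⁴⁰ ≤ 𝓛⁻⁷³⁹`);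
* `lemma31_holds` — **Lemma 3.1 is a theorem of the tree** (`Lemma31.lemma_3_1_complex`).

| node | locator | printed claim |
|---|---|---|
| `Lemma31`, `Lemma32` | §3 Lemmas 3.1, 3.2 | (A) ⇒ `Σ_{D⁴<n≤P²} ν(n)²/n ≪ 𝓛⁻²⁰¹¹`; (A) ⇒ `Σ_{D⁴<n≤D⁸} ν(n)²τ₂(n)²/n ≪ 𝓛⁻²⁰⁰⁷` |
| `Lemma33a`, `Lemma33b` | §3 Lemma 3.3 | `Σ_{ψ∈Ψ}|Σ_{n≤P} c(n)ψ(n)n^{−s}|² ≪ 𝔓Σ|c(n)|²n^{−2σ}`; with `P²`, `≪ P²Σ…` |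
| `Lemma34`, `Lemma35`, `Lemma36` | §3 Lemmas 3.4–3.6 | (3.4) fails for `≪ 𝔓𝓛⁻⁷⁴⁰` of `ψ ∈ Ψ`; (A) ⇒ (3.5), (3.6) fail for `≪ 𝔓𝓛⁻⁷³⁹` |
| `Lemma41`, `Lemma42`, `Lemma43` | §4 Lemmas 4.1–4.3 | `ψ ∈ Ψ₁`: `|F|+|G| ≪ 𝓛⁷⁹` on `Ω₁`; `FG = 1 + O(𝓛⁻²²⁷)` on `Ω₁`; `F′/F = O(𝓛)` on `Ω₂` |
| `Lemma44`, `Eq410` | §4 Lemma 4.4, (4.10) | `L(s,ψ)L(s,ψχ) = F + Z̃F(1−s,ψ̄) + O(𝓛⁻¹⁷⁹)` on `Ω₃`; `𝒜 = 1 + ℬ + O(𝓛⁻¹⁰⁰)` |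
| `Lemma45`, `Lemma46 c′`, `Lemma47 c′` | §4 Lemmas 4.5–4.7 | no zeros of `𝒜` off the line; simple zeros, local uniqueness; three zeros in `|w| < α(1+c′α𝓛)` |
| `Lemma48` | §4 Lemma 4.8 | `ρ` zero of `LL` in `Ω` ⇒ `Z̃(ρ)⁻¹ = −G(ρ)F(1−ρ,ψ̄) + O(𝓛⁻¹⁰⁰)` |

| `Ded22 c′`, `Ded23 c′` | §4 pp. 9–10; §2 p. 6 | the deductions "Lemma 4.2 + Lemmas 4.5–4.7 ⇒ Prop. 2.2" and "Prop. 2.2 ⇒ Lemma 2.3" as claims |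

The deduction "Lemma 4.5 and 4.6 together imply (i) and (ii) of Proposition 2.2 … it now suffices
to prove Lemma 4.7" (§4 p. 10) is recorded as the node `Ded22` (a claim), not kernel-checked here
(zero-counting with multiplicity), and likewise the p. 6 proof of Lemma 2.3 (`Ded23`). Objects: `Fpoly`, `Gpoly`, `FpolyBar` (`F(s,ψ)`, `G(s,ψ)`,
`F(s,ψ̄)`), `LL`, `tildeZW` (`Z̃ = Z(s,ψ)Z(s,ψχ)`, the tree's `GammaFactor.tildeZ`), `calA`, `calB`,
`Omega1/2/3` (the tree's `Lemma43.Omega1/2`).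

## References

* Y. Zhang, arXiv:2211.02515v1 (2022), §3 pp. 6–7, §4 pp. 7–10.
  [cite: Zhang2022LandauSiegel, §§3–4]
-/

noncomputable section

open Complex Real ComplexConjugate

namespace Literature.NumberTheory.LFunctions.Zhang2022.Skeleton

/-! ## §3: Lemmas 3.1–3.6 -/

/-- **Lemma 3.1** (§3 p. 6): "Assume (A) holds. Then `Σ_{D⁴<n≤P²} ν(n)²/n ≪ 𝓛⁻²⁰¹¹`" (3.2).
CLAIM — and a THEOREM of the tree (`lemma31_holds`). [cite: Zhang2022LandauSiegel, §3 Lemma 3.1] -/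
def Lemma31 : Prop :=
  ∃ C : ℝ, ForAllLarge fun D _ χ => AssumptionA D χ →
    ‖∑ n ∈ Finset.Ioc (D ^ 4) ⌊bigP D ^ 2⌋₊, nu χ n ^ 2 / (n : ℂ)‖ ≤ C / ell D ^ 2011

/-- **Lemma 3.2** (§3 p. 6, "a sketch only"): "Assume (A) holds. Then
`Σ_{D⁴<n≤D⁸} ν(n)²τ₂(n)²/n ≪ 𝓛⁻²⁰⁰⁷`." CLAIM. [cite: Zhang2022LandauSiegel, §3 Lemma 3.2] -/
def Lemma32 : Prop :=
  ∃ C : ℝ, ForAllLarge fun D _ χ => AssumptionA D χ →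
    ∑ n ∈ Finset.Ioc (D ^ 4) (D ^ 8), ‖nu χ n‖ ^ 2 * (n.divisors.card : ℝ) ^ 2 / n
      ≤ C / ell D ^ 2007

/-- **Lemma 3.3, first assertion** (§3 p. 6, "by the orthogonality relation"): for any `s` and any
`c(n)`, `Σ_{ψ∈Ψ} |Σ_{n≤P} c(n)ψ(n)n^{−s}|² ≪ 𝔓 Σ_{n≤P} |c(n)|²n^{−2σ}`. CLAIM.
[cite: Zhang2022LandauSiegel, §3 Lemma 3.3] -/
def Lemma33a : Prop :=
  ∃ C : ℝ, ∀ (D : ℕ) (s : ℂ) (c : ℕ → ℂ),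
    ∑ᶠ x : Chr D, ‖∑ n ∈ Finset.Icc 1 ⌊bigP D⌋₊, c n * x.ψ (n : ZMod x.p) * (n : ℂ) ^ (-s)‖ ^ 2
      ≤ C * frakP D * ∑ n ∈ Finset.Icc 1 ⌊bigP D⌋₊, ‖c n‖ ^ 2 * (n : ℝ) ^ (-2 * s.re)

/-- **Lemma 3.3, second assertion** (§3 p. 6, "by the large sieve inequality"): for any `s`, `c(n)`,
`Σ_{ψ∈Ψ} |Σ_{n≤P²} c(n)ψ(n)n^{−s}|² ≪ P² Σ_{n≤P²} |c(n)|²n^{−2σ}`. CLAIM.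
[cite: Zhang2022LandauSiegel, §3 Lemma 3.3] -/
def Lemma33b : Prop :=
  ∃ C : ℝ, ∀ (D : ℕ) (s : ℂ) (c : ℕ → ℂ),
    ∑ᶠ x : Chr D, ‖∑ n ∈ Finset.Icc 1 ⌊bigP D ^ 2⌋₊, c n * x.ψ (n : ZMod x.p) * (n : ℂ) ^ (-s)‖ ^ 2
      ≤ C * bigP D ^ 2 * ∑ n ∈ Finset.Icc 1 ⌊bigP D ^ 2⌋₊, ‖c n‖ ^ 2 * (n : ℝ) ^ (-2 * s.re)

/-- **Lemma 3.4** (§3 p. 7): "The inequality (3.4) holds for all but at most `O(𝔓𝓛⁻⁷⁴⁰)` characters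
`ψ` in `Ψ`." CLAIM. [cite: Zhang2022LandauSiegel, §3 Lemma 3.4] -/
def Lemma34 : Prop :=
  ∃ C : ℝ, ForAllLarge fun D _ χ =>
    (({x : Chr D | ¬ Ineq34 χ x}.ncard : ℕ) : ℝ) ≤ C * frakP D * (ell D ^ 740)⁻¹

/-- **Lemma 3.5** (§3 p. 7): "Assume that (A) holds. The inequality (3.5) holds for all but at most
`O(𝔓𝓛⁻⁷³⁹)` characters `ψ` in `Ψ`." CLAIM. [cite: Zhang2022LandauSiegel, §3 Lemma 3.5] -/
def Lemma35 : Prop :=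
  ∃ C : ℝ, ForAllLarge fun D _ χ => AssumptionA D χ →
    (({x : Chr D | ¬ Ineq35 χ x}.ncard : ℕ) : ℝ) ≤ C * frakP D * (ell D ^ 739)⁻¹

/-- **Lemma 3.6** (§3 p. 7): "Assume that (A) holds. The inequality (3.6) holds for all but at most
`O(𝔓𝓛⁻⁷³⁹)` characters `ψ` in `Ψ`." CLAIM. [cite: Zhang2022LandauSiegel, §3 Lemma 3.6] -/
def Lemma36 : Prop :=
  ∃ C : ℝ, ForAllLarge fun D _ χ => AssumptionA D χ →
    (({x : Chr D | ¬ Ineq36 χ x}.ncard : ℕ) : ℝ) ≤ C * frakP D * (ell D ^ 739)⁻¹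

/-- `𝓛 ≥ 1` eventually (indeed for `D ≥ 3`). [cite: Zhang2022LandauSiegel, §2 (2.1)] -/
private theorem one_le_ell_of_three_le {D : ℕ} (hD : 3 ≤ D) : 1 ≤ ell D := by
  have hD' : (3 : ℝ) ≤ D := by exact_mod_cast hD
  have h : (1 : ℝ) < Real.log 3 := by
    rw [Real.lt_log_iff_exp_lt (by norm_num)]
    exact Real.exp_one_lt_d9.trans (by norm_num)
  exact le_trans h.le (Real.log_le_log (by norm_num) hD')

/-- **§3 p. 7: "Proposition 2.1 follows from Lemma 3.4, 3.5 and 3.6 immediately"** — `Ψ₂` is the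
union of the three exceptional sets, so `#Ψ₂ ≤ (C₄ + C₅ + C₆)𝔓𝓛⁻⁷³⁹` (`𝓛⁻⁷⁴⁰ ≤ 𝓛⁻⁷³⁹`).
Kernel-checked. [cite: Zhang2022LandauSiegel, §3 p. 7] -/
theorem prop21_of_lemmas (h34 : Lemma34) (h35 : Lemma35) (h36 : Lemma36) : Prop21 := by
  obtain ⟨C₄, h4⟩ := h34
  obtain ⟨C₅, h5⟩ := h35
  obtain ⟨C₆, h6⟩ := h36
  refine ⟨max C₄ 0 + max C₅ 0 + max C₆ 0, ?_⟩
  obtain ⟨D₀, h⟩ := (h4.and h5).and h6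
  refine ⟨max D₀ 3, fun D _ χ hD hq hp hA => ?_⟩
  obtain ⟨⟨h4', h5'⟩, h6'⟩ := h D χ (le_trans (le_max_left _ _) hD) hq hp
  have hD3 : 3 ≤ D := le_trans (le_max_right _ _) hD
  have hℓ : 1 ≤ ell D := one_le_ell_of_three_le hD3
  have hP : 0 ≤ frakP D := by
    rw [frakP_eq_sum_primeWindow]; exact Finset.sum_nonneg fun p _ => Nat.cast_nonneg p
  set X : ℝ := frakP D * (ell D ^ 739)⁻¹ with hX
  have hX0 : 0 ≤ X := by positivity
  have h740 : (ell D ^ 740)⁻¹ ≤ (ell D ^ 739)⁻¹ :=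
    inv_anti₀ (by positivity) (pow_le_pow_right₀ hℓ (by norm_num))
  -- the three exceptional sets
  set S₄ : Set (Chr D) := {x | ¬ Ineq34 χ x}
  set S₅ : Set (Chr D) := {x | ¬ Ineq35 χ x}
  set S₆ : Set (Chr D) := {x | ¬ Ineq36 χ x}
  have hsub : PsiTwo χ ⊆ (S₄ ∪ S₅) ∪ S₆ := by
    intro x hx
    simp only [PsiTwo, PsiOne, Set.mem_compl_iff, Set.mem_setOf_eq, not_and_or] at hx
    simp only [S₄, S₅, S₆, Set.mem_union, Set.mem_setOf_eq]
    tauto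
  have hcard : (PsiTwo χ).ncard ≤ S₄.ncard + S₅.ncard + S₆.ncard :=
    (Set.ncard_le_ncard hsub (Set.toFinite _)).trans
      ((Set.ncard_union_le _ _).trans (by gcongr; exact Set.ncard_union_le _ _))
  have e4 : (S₄.ncard : ℝ) ≤ max C₄ 0 * X := by
    calc (S₄.ncard : ℝ) ≤ C₄ * frakP D * (ell D ^ 740)⁻¹ := h4'
      _ ≤ max C₄ 0 * frakP D * (ell D ^ 740)⁻¹ := by gcongr; exact le_max_left _ _
      _ ≤ max C₄ 0 * frakP D * (ell D ^ 739)⁻¹ := by gcongr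
      _ = max C₄ 0 * X := by rw [hX]; ring
  have e5 : (S₅.ncard : ℝ) ≤ max C₅ 0 * X := by
    calc (S₅.ncard : ℝ) ≤ C₅ * frakP D * (ell D ^ 739)⁻¹ := h5' hA
      _ ≤ max C₅ 0 * frakP D * (ell D ^ 739)⁻¹ := by gcongr; exact le_max_left _ _
      _ = max C₅ 0 * X := by rw [hX]; ring
  have e6 : (S₆.ncard : ℝ) ≤ max C₆ 0 * X := by
    calc (S₆.ncard : ℝ) ≤ C₆ * frakP D * (ell D ^ 739)⁻¹ := h6' hA
      _ ≤ max C₆ 0 * frakP D * (ell D ^ 739)⁻¹ := by gcongr; exact le_max_left _ _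
      _ = max C₆ 0 * X := by rw [hX]; ring
  calc ((PsiTwo χ).ncard : ℝ) ≤ (S₄.ncard : ℝ) + S₅.ncard + S₆.ncard := by exact_mod_cast hcard
    _ ≤ max C₄ 0 * X + max C₅ 0 * X + max C₆ 0 * X := by linarith
    _ = (max C₄ 0 + max C₅ 0 + max C₆ 0) * frakP D * (ell D ^ 739)⁻¹ := by rw [hX]; ring

/-- `⌊P²⌋₊ ≤ exp(2𝓛⁹)` (`P² = exp(2𝓛⁹)`). [cite: Zhang2022LandauSiegel, §2 (2.6)] -/
private theorem floor_bigP_sq_le (D : ℕ) : (⌊bigP D ^ 2⌋₊ : ℝ) ≤ Real.exp (2 * Real.log D ^ 9) := by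
  have h : bigP D ^ 2 = Real.exp (2 * Real.log D ^ 9) := by
    rw [bigP, ell, ← Real.exp_nat_mul]; norm_num
  rw [← h]
  exact Nat.floor_le (by positivity)

/-- **Lemma 3.1 is a theorem of the tree**: the node `Lemma31` HOLDS, by `Lemma31.lemma_3_1_complex`
(the tree's `divisorSumChar χ` is `ν`). [cite: Zhang2022LandauSiegel, §3 Lemma 3.1] -/
theorem lemma31_holds : Lemma31 := by
  obtain ⟨C, hC⟩ := Lemma31.lemma_3_1_complex
  refine ⟨C, ⌈Real.exp 3⌉₊, fun D _ χ hD hq hp hA => ?_⟩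
  have hlog : 3 ≤ Real.log D := by
    have h : Real.exp 3 ≤ D := le_trans (Nat.le_ceil _) (by exact_mod_cast hD)
    exact (Real.le_log_iff_exp_le (lt_of_lt_of_le (Real.exp_pos _) h)).mpr h
  have h := hC D χ hp hq.sq_eq_one hlog (le_of_lt hA) ⌊bigP D ^ 2⌋₊ (floor_bigP_sq_le D)
  simpa [nu, ell] using h

/-- `Lemma31` — `_holds` alias of `lemma31_holds` above under the fact's exact name (appended
2026-08-28, D-0026 bookkeeping: the proof term is the existing theorem of this file; no statement,
definition or attribute is edited; no new named fact; the ledger's debt table listed the fact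
unproved). [cite: Zhang2022LandauSiegel, §3 Lemma 3.1] -/
theorem _root_.Literature.NumberTheory.LFunctions.Zhang2022.Skeleton.Lemma31_holds : Lemma31 :=
  _root_.Literature.NumberTheory.LFunctions.Zhang2022.Skeleton.lemma31_holds

/-! ## §4: `F`, `G`, `Z̃`, `𝒜`, `ℬ` and Lemmas 4.1–4.8 -/

section SectionFour

variable {D : ℕ} [NeZero D] (χ : DirichletCharacter ℂ D) (x : Chr D)

/-- `F(s,ψ) = Σ_{n≤D⁴} ν(n)ψ(n)n^{−s}` (§3 p. 6). [cite: Zhang2022LandauSiegel, §3 p. 6] -/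
def Fpoly (s : ℂ) : ℂ :=
  ∑ n ∈ Finset.Icc 1 (D ^ 4), nu χ n * x.ψ (n : ZMod x.p) * (n : ℂ) ^ (-s)

/-- `G(s,ψ) = Σ_{n≤D⁴} υ(n)ψ(n)n^{−s}` (§3 p. 6). [cite: Zhang2022LandauSiegel, §3 p. 6] -/
def Gpoly (s : ℂ) : ℂ :=
  ∑ n ∈ Finset.Icc 1 (D ^ 4), ups χ n * x.ψ (n : ZMod x.p) * (n : ℂ) ^ (-s)

/-- `F(s,ψ̄) = Σ_{n≤D⁴} ν(n)ψ̄(n)n^{−s}` (used at `1 − s` in (4.4), Lemma 4.4, Lemma 4.8).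
[cite: Zhang2022LandauSiegel, §4 Lemma 4.4] -/
def FpolyBar (s : ℂ) : ℂ :=
  ∑ n ∈ Finset.Icc 1 (D ^ 4), nu χ n * conj (x.ψ (n : ZMod x.p)) * (n : ℂ) ^ (-s)

/-- `L(s,ψ)L(s,ψχ)`. [cite: Zhang2022LandauSiegel, §4 (4.4)] -/
def LL (s : ℂ) : ℂ := x.ψ.LFunction s * (psiChi χ x).LFunction s

/-- `Z̃(s,ψ) = Z(s,ψ)Z(s,ψχ)` (§4 p. 8, the tree's `GammaFactor.tildeZ`).
[cite: Zhang2022LandauSiegel, §4 (4.4)] -/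
def tildeZW (s : ℂ) : ℂ := GammaFactor.tildeZ x.ψ (psiChi χ x) s

/-- `𝒜(s,ψ) = L(s,ψ)L(s,ψχ)/F(s,ψ)` (§4 p. 9). [cite: Zhang2022LandauSiegel, §4 (4.10)] -/
def calA (s : ℂ) : ℂ := LL χ x s / Fpoly χ x s

/-- `ℬ(s,ψ) = Z̃(s,ψ)F(1−s,ψ̄)/F(s,ψ)` (§4 p. 9). [cite: Zhang2022LandauSiegel, §4 (4.10)] -/
def calB (s : ℂ) : ℂ := tildeZW χ x s * FpolyBar χ x (1 - s) / Fpoly χ x s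

omit [NeZero D] in
/-- `Ω₁` of Lemma 4.1 (the tree's `Lemma43.Omega1 𝓛 𝓛₁ t₀`). [cite: Zhang2022LandauSiegel, §4 Lemma 4.1] -/
def Omega1 (D : ℕ) : Set ℂ := Lemma43.Omega1 (ell D) (ell1 D) (t0 D)

omit [NeZero D] in
/-- `Ω₂` of Lemma 4.3 (the tree's `Lemma43.Omega2 𝓛 𝓛₁ t₀`). [cite: Zhang2022LandauSiegel, §4 Lemma 4.3] -/
def Omega2 (D : ℕ) : Set ℂ := Lemma43.Omega2 (ell D) (ell1 D) (t0 D)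

omit [NeZero D] in
/-- `Ω₃ = {1/2 − α < σ < 1 + α, |t − 2πt₀| < 𝓛₁ + 3}` of Lemma 4.4.
[cite: Zhang2022LandauSiegel, §4 Lemma 4.4] -/
def Omega3 (D : ℕ) : Set ℂ :=
  {s | 1 / 2 - alpha D < s.re ∧ s.re < 1 + alpha D ∧ |s.im - 2 * π * t0 D| < ell1 D + 3}

end SectionFour

/-- **Lemma 4.1** (§4 p. 7): for `ψ ∈ Ψ₁` and `s ∈ Ω₁`, "`|F(s,ψ)| + |G(s,ψ)| ≪ 𝓛⁷⁹`". CLAIM.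
[cite: Zhang2022LandauSiegel, §4 Lemma 4.1] -/
def Lemma41 : Prop :=
  ∃ C : ℝ, ForAllLarge fun D _ χ => ∀ x ∈ PsiOne χ, ∀ s ∈ Omega1 D,
    ‖Fpoly χ x s‖ + ‖Gpoly χ x s‖ ≤ C * ell D ^ 79

/-- **Lemma 4.2** (§4 p. 8): for `ψ ∈ Ψ₁` and `s ∈ Ω₁`, "`F(s,ψ)G(s,ψ) = 1 + O(𝓛⁻²²⁷)`". CLAIM.
[cite: Zhang2022LandauSiegel, §4 Lemma 4.2] -/
def Lemma42 : Prop :=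
  ∃ C : ℝ, ForAllLarge fun D _ χ => ∀ x ∈ PsiOne χ, ∀ s ∈ Omega1 D,
    ‖Fpoly χ x s * Gpoly χ x s - 1‖ ≤ C * (ell D ^ 227)⁻¹

/-- **Lemma 4.3** (§4 p. 8): for `ψ ∈ Ψ₁` and `s ∈ Ω₂`, "`(F′/F)(s,ψ) = O(𝓛)`". CLAIM.
[cite: Zhang2022LandauSiegel, §4 Lemma 4.3] -/
def Lemma43 : Prop :=
  ∃ C : ℝ, ForAllLarge fun D _ χ => ∀ x ∈ PsiOne χ, ∀ s ∈ Omega2 D,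
    ‖deriv (Fpoly χ x) s / Fpoly χ x s‖ ≤ C * ell D

/-- **Lemma 4.4** (§4 p. 8, the approximate functional equation): for `ψ ∈ Ψ₁` and `s ∈ Ω₃`,
"`L(s,ψ)L(s,ψχ) = F(s,ψ) + Z̃(s,ψ)F(1−s,ψ̄) + O(𝓛⁻¹⁷⁹)`". CLAIM.
[cite: Zhang2022LandauSiegel, §4 Lemma 4.4] -/
def Lemma44 : Prop :=
  ∃ C : ℝ, ForAllLarge fun D _ χ => ∀ x ∈ PsiOne χ, ∀ s ∈ Omega3 D,
    ‖LL χ x s - Fpoly χ x s - tildeZW χ x s * FpolyBar χ x (1 - s)‖ ≤ C * (ell D ^ 179)⁻¹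

/-- **(4.10)** (§4 p. 9, from Lemmas 4.1, 4.2, 4.4): for `ψ ∈ Ψ₁` and `s ∈ Ω₃`,
"`𝒜(s,ψ) = 1 + ℬ(s,ψ) + O(𝓛⁻¹⁰⁰)`". CLAIM. [cite: Zhang2022LandauSiegel, §4 (4.10)] -/
def Eq410 : Prop :=
  ∃ C : ℝ, ForAllLarge fun D _ χ => ∀ x ∈ PsiOne χ, ∀ s ∈ Omega3 D,
    ‖calA χ x s - 1 - calB χ x s‖ ≤ C * (ell D ^ 100)⁻¹

/-- **Lemma 4.5** (§4 p. 9): for `ψ ∈ Ψ₁`, "if `1/2 + α² < σ < 1`, `|t − 2πt₀| < 𝓛₁ + 2`, then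
`𝒜(s,ψ) ≠ 0`." CLAIM. [cite: Zhang2022LandauSiegel, §4 Lemma 4.5] -/
def Lemma45 : Prop :=
  ForAllLarge fun D _ χ => ∀ x ∈ PsiOne χ, ∀ s : ℂ,
    1 / 2 + alpha D ^ 2 < s.re → s.re < 1 → |s.im - 2 * π * t0 D| < ell1 D + 2 → calA χ x s ≠ 0

/-- **Lemma 4.6** (§4 p. 9): for `ψ ∈ Ψ₁`, "suppose `ρ = β + iγ` is a zero of `𝒜(s,ψ)` with
`1/2 ≤ β < 1/2 + α²`, `|γ − 2πt₀| < 𝓛₁ + 2`. Then `β = 1/2`, `𝒜′(ρ,ψ) ≠ 0` and `𝒜(1/2+iγ+w,ψ) ≠ 0`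
if `0 < |w| < α(1 − c′α𝓛)` where `c′` is a sufficiently [large] constant." CLAIM.
[cite: Zhang2022LandauSiegel, §4 Lemma 4.6] -/
def Lemma46 (c' : ℝ) : Prop :=
  ForAllLarge fun D _ χ => ∀ x ∈ PsiOne χ, ∀ ρ : ℂ, calA χ x ρ = 0 →
    1 / 2 ≤ ρ.re → ρ.re < 1 / 2 + alpha D ^ 2 → |ρ.im - 2 * π * t0 D| < ell1 D + 2 →
      ρ.re = 1 / 2 ∧ deriv (calA χ x) ρ ≠ 0 ∧
        ∀ w : ℂ, 0 < ‖w‖ → ‖w‖ < alpha D * (1 - c' * alpha D * ell D) → calA χ x (ρ + w) ≠ 0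

/-- **Lemma 4.7** (§4 p. 10): for `ψ ∈ Ψ₁` and a zero `ρ = 1/2 + iγ` of `𝒜(s,ψ)`,
`|γ − 2πt₀| < 𝓛₁ + 2`, "the function `𝒜(ρ+w,ψ)` has exactly three zeros inside the circle
`|w| = α(1 + c′α𝓛)`, counted with multiplicity" — typed as three DISTINCT zeros (they are simple by
Lemma 4.6, which is how the manuscript uses it for the gap assertion (iii)). CLAIM.
[cite: Zhang2022LandauSiegel, §4 Lemma 4.7] -/
def Lemma47 (c' : ℝ) : Prop :=
  ForAllLarge fun D _ χ => ∀ x ∈ PsiOne χ, ∀ ρ : ℂ, calA χ x ρ = 0 → ρ.re = 1 / 2 →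
    |ρ.im - 2 * π * t0 D| < ell1 D + 2 →
      {w : ℂ | ‖w‖ < alpha D * (1 + c' * alpha D * ell D) ∧ calA χ x (ρ + w) = 0}.ncard = 3

/-- **Lemma 4.8** (§4 p. 10): "Assume that `ρ` is a zero of `L(s,ψ)L(s,ψχ)` in `Ω` [`ψ ∈ Ψ₁`].
Then `Z̃(ρ,ψ)⁻¹ = −G(ρ,ψ)F(1−ρ,ψ̄) + O(𝓛⁻¹⁰⁰)`." CLAIM (consumed in §13 via (13.3)).
[cite: Zhang2022LandauSiegel, §4 Lemma 4.8] -/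
def Lemma48 : Prop :=
  ∃ C : ℝ, ForAllLarge fun D _ χ => ∀ x ∈ PsiOne χ, ∀ ρ ∈ prodZeroSetOmega χ x,
    ‖(tildeZW χ x ρ)⁻¹ + Gpoly χ x ρ * FpolyBar χ x (1 - ρ)‖ ≤ C * (ell D ^ 100)⁻¹

/-! ## The deductions of §4 p. 9–10 and §2 p. 6 as named nodes -/

/-- **§4 pp. 9–10: "The proof of Proposition 2.2 is reduced to proving three lemmas"** — "By
Lemma 4.2, `𝒜(s,ψ)` is analytic and it has the same zeros as `L(s,ψ)L(s,ψχ)` in `Ω₁`"; "Lemma 4.5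
and 4.6 together imply the assertions (i) and (ii) of Proposition 2.2" (zeros with `σ < 1/2` being
reflected to `σ > 1/2` by the functional equation; Lemma 4.5 covers `1/2 + α² < σ < 1`, Lemma 4.6
covers `1/2 ≤ β < 1/2 + α²` — the boundary `β = 1/2 + α²` is where the two printed ranges meet);
"To complete the proof of the gap assertion (iii), it now suffices to prove Lemma 4.7". The
DEDUCTION itself as a claim (edge not kernel-checked). CLAIM.
[cite: Zhang2022LandauSiegel, §4 pp. 9–10] -/
def Ded22 (c' : ℝ) : Prop := Lemma42 → Lemma45 → Lemma46 c' → Lemma47 c' → Prop22 c'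

/-- **§2 p. 6, proof of Lemma 2.3 from Proposition 2.2**: "By [Prop. 2.2 (iii)] we see that
`M(ρ+iv,ψ) ≠ 0` if `|β₂| ≤ v ≤ |β₃|`. Thus, by (2.11), (2.12) and the mean-value theorem, …
`M(ρ+β₂,ψ)·M(ρ+β₃,ψ) > 0`"; "`M(ρ+iv,ψ) ≠ 0` if `0 < v ≤ |β₁|`" and the limit `v → 0⁺` using the
simplicity (ii) (`M′(ρ,ψ) ≠ 0`), whence `𝔠*(ρ,ψ) ≥ 0`. The DEDUCTION itself as a claim (edge not
kernel-checked). CLAIM. [cite: Zhang2022LandauSiegel, §2 p. 6] -/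
def Ded23 (c' : ℝ) : Prop := Prop22 c' → Lemma23 c'

end Literature.NumberTheory.LFunctions.Zhang2022.Skeleton
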